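import Literature.Probability.Percolation.SlabCircuitTheorem310
import Literature.Probability.Percolation.SlabCircuitCornerGlueOne
import Literature.Probability.Percolation.SlabCircuitCornerGlueTransport
import Literature.Probability.Percolation.SlabCircuitSmallP
import HarnessLib

/-!
# Newman–Tassion–Wu 2017, Theorem 3.10 — PROVED: open circuits in annuli from hard crossings, on
# every slab

Topic: `Literature/Probability/Percolation`. Twentieth and last file of the port of THEOREM 3.10 of
Newman–Tassion–Wu, *Critical percolation and the minimal spanning tree in slabs* (CPAM 70 (2017);
arXiv:1512.09107, pp. 12–14): "Let `k, n ≥ 1` and `ε, c > 0`. There exist `λ = λ(k,c,ε) ≥ 1` and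
`c' = c'(k,c,ε) > 0` such that for every `p ∈ [ε, 1-ε]`, `P_p[H(2n,n)] ≥ c` implies
`P_p[𝒜_{λn,2λn}(z)] ≥ c'` for every `z`" — in the form `h310` consumed by the assembly
`Crossing.NewmanTassionWu2017_thm31_of_four` of Theorem 3.1 (with `n ≥ m₀`, any
`m₀ ≥ max 52 (k+1)`). The capstone `h310_of_cornerGlue` (`SlabCircuitTheorem310.lean`) reduced it to
the corner-gluing inequalities (HG) and the small-parameter bound (HL); here both are supplied:

* `cornerGlue_all` — (HG): for every `ε > 0`, with `K = (2/ε)^{s₁(k)}`, all four corner gluings hold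
  for every `p ∈ [ε, 1-ε]`, every hole size `N ≥ 2` and every width `n` (`cornerGlue₁_holds` and the
  quarter-turn transport);
* `h310_holds` — THEOREM 3.10.

## Sources

* C. M. Newman, V. Tassion, W. Wu, *Critical percolation and the minimal spanning tree in slabs*,
  Comm. Pure Appl. Math. 70 (2017) 2084–2120, arXiv:1512.09107: Theorem 3.10 and its proof
  (pp. 12–14) [NewmanTassionWu2017].
-/

noncomputable section

namespace Literature.Probability.Percolation

open MeasureTheory LatticeModels SimpleGraph

namespace NTW17

variable {k : ℕ}

/-- **(HG): the four corner-gluing inequalities, uniformly on `[ε, 1-ε]`.** For every `ε > 0`, with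
`K = (2/ε)^{s₁(k)}`: `CornerGlue₁..₄ k N n p K` for every `p ∈ [ε, 1-ε]`, `N ≥ 2`, and every `n`.
[cite: NewmanTassionWu2017, Theorem 3.10 (proof, (3.121)–(3.122))] -/
theorem cornerGlue_all (hk : 1 ≤ k) :
    ∀ ε : ℝ, 0 < ε → ∃ K : ℝ, 0 ≤ K ∧ ∀ p : unitInterval, ε ≤ (p : ℝ) → (p : ℝ) ≤ 1 - ε →
      ∀ N n : ℕ, 2 ≤ N → CornerGlue₁ k N n p K ∧ CornerGlue₂ k N n p K ∧ CornerGlue₃ k N n p K ∧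
        CornerGlue₄ k N n p K := by
  intro ε hε
  refine ⟨(2 / ε) ^ (3 * ((5 * k + 4) * (2 * (2 * 3) + 1) ^ 2)), by positivity, fun p hpε hp1ε N n hN => ?_⟩
  have hp0 : 0 < (p : ℝ) := lt_of_lt_of_le hε hpε
  have hp1 : (p : ℝ) < 1 := by linarith
  have hlam : (2 / min (p : ℝ) (1 - p)) ^ (3 * ((5 * k + 4) * (2 * (2 * 3) + 1) ^ 2)) ≤ (2 / ε) ^ (3 * ((5 * k + 4) * (2 * (2 * 3) + 1) ^ 2)) := by
    apply pow_le_pow_left₀ (by positivity)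
    exact div_le_div_of_nonneg_left (by norm_num) hε (le_min hpε (by linarith))
  have h₁ : CornerGlue₁ k N n p ((2 / ε) ^ (3 * ((5 * k + 4) * (2 * (2 * 3) + 1) ^ 2))) :=
    cornerGlue₁_mono hlam (cornerGlue₁_holds hk (by omega) n p hp0 hp1)
  have h₂ := cornerGlue₂_of_cornerGlue₁ h₁
  have h₃ := cornerGlue₃_of_cornerGlue₂ h₂
  exact ⟨h₁, h₂, h₃, cornerGlue₄_of_cornerGlue₃ h₃⟩

/-- **NTW 2017, THEOREM 3.10 (open circuits in annuli from hard crossings), PROVED** — in the form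
`h310` of `Crossing.NewmanTassionWu2017_thm31_of_four`, for every `m₀ ≥ max 52 (k+1)`:
`∀ ε>0 ∀ c>0 ∃ λ ≥ 1 ∃ c'>0 ∀ p ∈ [ε,1-ε] ∀ n ≥ m₀, c ≤ f_p(2n,n-1) ⟹ ∀ z, c' ≤ P_p[circuitAround k z (λn) (2λn)]`.
[cite: NewmanTassionWu2017, Theorem 3.10] -/
theorem h310_holds (hk : 1 ≤ k) {m₀ : ℕ} (hm₀ : 52 ≤ m₀) (hm₀' : k + 1 ≤ m₀) :
    ∀ ε : ℝ, 0 < ε → ∀ c : ℝ, 0 < c → ∃ lam : ℕ, 1 ≤ lam ∧ ∃ c' : ℝ, 0 < c' ∧ ∀ p : unitInterval,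
      ε ≤ (p : ℝ) → (p : ℝ) ≤ 1 - ε → ∀ n : ℕ, m₀ ≤ n → c ≤ crossingProb k p (2 * n) (n - 1) →
      ∀ z : ℤ × ℤ, c' ≤ (bondPercolation (slabGraph 3 k) p).real (circuitAround k z (lam * n) (2 * (lam * n))) :=
  h310_of_cornerGlue hk hm₀ hm₀' (cornerGlue_all hk) (ε₀ := 1 / 12) (by norm_num) (hl_smallP k)

end NTW17

end Literature.Probability.Percolation

end
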